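import Summits.QuantumFields.BalabanUV.Beta.PeriodisedIndexLawSummable
import Summits.QuantumFields.BalabanUV.Beta.CombLamSectorLetters

/-!
# `BalabanUV.Beta.CombLamSectorPeriodised` — binder row D1 (OWNER an2), (J-a) dictionary: **THE Λ-SECTOR OF THE FULL FIRST-ORDER JET, PERIODISED —
# THE TWO Λ ROWS OF THE GRADED (β) DOOR (`hΛ`, `hΛt` of leaf-02's `FP/NestedStepLawTorusTransportedRowsGradedLevelZeroSym`) AS THEOREMS FOR THE
# Λ FAMILIES OF RECORD** (level 0 and level `j`), on the ℓ¹ engine `PeriodisedIndexLawSummable`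

WHY.  The (β) door of road «FP» (leaf-02 g21, INTENT 11) carries the Λ half of the field–field first-order jet as a FREE additive family `Λ b` (`b = (u, κ)` a
torus bond of `F = fine Lc M′`) and DISPLAYS its two rows: `hΛ : Σ_b (Dλ)_b • Λ b = 0` (the periodised Λ index law along a pure gauge `Dλ`,
`(Dλ)_b = Σ_s tgrad F (b.1, inl b.2) s · λ s`) and `hΛt : (Λ b)ᵀ = −Λ b`.  Per fine SITE the Λ sector of the literal of record is gauge-NULL at every level
(`CombLamSectorLetters.divV_SLam_lamCoeffOf_an1TablesS2_eq_zero ∕ divV_SLam_lamCoeffK_an1TablesS2_eq_zero`, (Λ-g)), signed-transpose-odd and field–field-supported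
((Λ-p), (Λ-ff)), block covariant ((Λ-t)); it is exponentially localised, not finitely supported — hence the ℓ¹ engine.

CONTENT ([folklore] bookkeeping over OUR typed objects BY NAME; no `def`, no `def … : Prop`, nothing cited, 0 sorry): the Λ families of record — level 0
`V := SLam Lc (lamCoeffOf KInv Lc) (symHessFFAt ρ_c Lc)`, level `j` `V_j := SLam Lc (lamCoeffK (KInvStep Lc j) (E2 d Lc j) Lc) (symHessFFAt ρ_c Lc)`:
`locStencil_SLam_an1TablesS2` ∕ `locStencil_SLam_lamCoeffK_an1TablesS2` ((Λ-loc): lit-balaban's `locStencil_SLam` fed `abs_lamCoeffOf_le` ∕ `abs_lamCoeffK_le`,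
`decays_KInv` ∕ `decays_KInvStep` + `decays_E2`, an1's `vertexFamily_symHessFFAt`); `trF_SLam_an1TablesS2` (`trF (V κ u) = −V κ u` from (Λ-p) + (Λ-ff), ANY
coefficients); `perF_dper_SLam_an1TablesS2_transpose`; and the door's rows VERBATIM at `Λ b := w • (perF T (dper T (V b.2 ↑b.1)))∘(ff)`, any weight `w`, any torus
gauge function, any period box `T = Lc·M′`: **`torus_Lam_family_transpose`** (`hΛt`, any coefficients), **`torus_Lam_indexLaw`** ∕ **`torus_Lam_indexLaw_lamCoeffK`**
(`hΛ`, level 0 ∕ level `j`), and the `…_fine` forms at the (III′) call's `T := fine Lc M′` with leaf-02's INTENT-11 binder types (`hΛ := torus_Lam_indexLaw_fine w lam`,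
`hΛt := fun b => torus_Lam_family_transpose_fine _ w b`).

WHAT THIS DOES NOT SAY: which weight `w` the instance puts on the Λ family (the road's currency; JA-TABLE v1.3 Λ-ROW gives the dictionary's), nor anything
about the Wilson ∕ form half (`CombFormSlotPeriodised`, leaf-05's `torus_k1_sim_letter`), the order-2 rows, or the (γ-sym) sockets.  0 estimates beyond the
[folklore] summabilities; 0∕4 row-D1 binders; `D1Tel` ∕ `D1Rep` OPEN; NOT (T-ID), NOT (J-a) complete, NOT D1, NEVER «G-an2-4 closed», NOT BetaPertH, NOT
continuum, NOT Clay.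

HONEST DEPENDENCY (page 1, mandatory): continuum YM on T⁴ ⇐ BetaPertH ∧ nine spine estimates (0/9 proved); BetaPertH ⇐ (D1) ∧ (D4) ∧ CAP+tail;
G-an2-4 gates asym, D1 and NE2/3/4.  HONEST FRAMING (cell contract, verbatim): «discharging `BetaPertH` makes Bałaban's UV stability UNCONDITIONAL —
a real constructive-QFT result; it is NOT the continuum limit and NOT the Clay problem.»  ABSOLUTE RULE (cell charter, verbatim): «No internally-minted
statement may enter as a cited fact. Every hypothesis is either kernel-proved in this package or a verbatim quotation of a PUBLISHED theorem with page
reference. The manuscript(s) under audit are NOT citable for their own disputed steps — they are the thing under adjudication; programme-internal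
(2001/route/tribunal) claims are never citable.»  Row D1 OWNER an2 (b2b-balaban-beta-an2) gen 41, 2026-08-22.  No existing file touched.
-/

noncomputable section

open scoped BigOperators Matrix
open Finset

namespace Summit.QuantumFields.BalabanUV.Beta.CombLamSectorPeriodised

open Literature.MathematicalPhysics.QuantumFieldTheory
open Literature.MathematicalPhysics.QuantumFieldTheory.Balaban1983to89
open Literature.MathematicalPhysics.QuantumFieldTheory.Balaban1983to89.Beta
open B4TorusKernel.MultiPeriod (translate)
open B5Prop11Plancherel (fine)
open B6Lemma24Torus (pbox)
open ExpKernelCalculus (MKer Decays BiLoc shiftK)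
open AffineAveraging (Site)
open AveragingContoursRooted (ctr ctrOff ctrOff_mem_box)
open OneStepResolventKernel (Fib KInv decays_KInv LocStencil decays_mono)
open OneStepKernelFamily (KInvStep decays_KInvStep)
open BalabanStepJets (lamCoeffOf abs_lamCoeffOf_le)
open BalabanStepJetsSucc (E2 decays_E2 lamCoeffK abs_lamCoeffK_le)
open InterLevelTransport (SLam locStencil_SLam)
open Summit.QuantumFields.BalabanUV.Beta.TameKernelCalculus (trK trK_apply)
open Summit.QuantumFields.BalabanUV.Beta.BorderedHessian (sgnK sgnF_inl sgnF_inr)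
open Summit.QuantumFields.BalabanUV.Beta.FP.KernelPeriodisationFib (Idx perF perF_apply perZ perZ_apply trF)
open Summit.QuantumFields.BalabanUV.Beta.FP.KernelPeriodisationFibLoc (dper)
open Summit.QuantumFields.BalabanUV.Beta.FP.TorusGaugeCovariance (tgrad)
open Summit.QuantumFields.BalabanUV.Beta.SymAveragingHessianCounts (symHessFFAt vertexFamily_symHessFFAt)
open Summit.QuantumFields.BalabanUV.Beta.CombLamSectorLetters (divV_SLam_lamCoeffOf_an1TablesS2_eq_zero divV_SLam_lamCoeffK_an1TablesS2_eq_zero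
  SLam_an1TablesS2_translate trK_SLam_an1TablesS2 SLam_an1TablesS2_inl_inr SLam_an1TablesS2_inr)
open Summit.QuantumFields.BalabanUV.Beta.PeriodisedIndexLawSummable (perF_dper_transpose_of_trF torus_indexLaw_ff_of_divV_eq_zero)

variable {d : ℕ}

/-! ## §2 The Λ families OF RECORD: level 0 `SLam Lc (lamCoeffOf KInv Lc) (symHessFFAt ρ_c Lc)`, level `j` `SLam Lc (lamCoeffK (KInvStep Lc j) (E2 d Lc j) Lc) (symHessFFAt ρ_c Lc)`
— localisation, antisymmetry (any coefficients), and the door's two rows -/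

section Record

variable {Lc : ℕ} [NeZero Lc]

/-- [folklore] **(Λ-loc) THE Λ FAMILY OF RECORD IS A LOCAL STENCIL FAMILY** (some rate `δ > 0`, constant `C ≥ 0`): lit-balaban's `locStencil_SLam` fed the
coefficient decay `abs_lamCoeffOf_le` (from `decays_KInv`) and an1's `vertexFamily_symHessFFAt` at the centred root. -/
theorem locStencil_SLam_an1TablesS2 :
    ∃ C δ : ℝ, 0 ≤ C ∧ 0 < δ ∧
      LocStencil (SLam Lc (lamCoeffOf (KInv (N := Lc) (d := d)) Lc) (symHessFFAt (ctr (d + 1) Lc) Lc)) C δ := by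
  obtain ⟨δ₀, C, hδ₀, hC, hdec⟩ := decays_KInv (N := Lc) (d := d)
  have hLc : 1 ≤ Lc := Nat.one_le_iff_ne_zero.2 (NeZero.ne Lc)
  have hc := abs_lamCoeffOf_le (N := Lc) hdec hC hδ₀.le
  have hQ := vertexFamily_symHessFFAt (d := d) hLc (ctrOff_mem_box hLc) hδ₀.le
  have h3 := locStencil_SLam (N := Lc) hc hQ hδ₀ (mul_nonneg (mul_nonneg (by positivity) hC) (Real.exp_pos _).le)
  refine ⟨_, δ₀ / 2, ?_, half_pos hδ₀, h3⟩
  have h0 := h3 0 0 0 0 (Sum.inl 0) (Sum.inl 0)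
  exact (mul_nonneg_iff_of_pos_right (Real.exp_pos _)).1 ((abs_nonneg _).trans h0)

/-- [folklore] **(Λ-loc)ⱼ THE LEVEL-`j` Λ FAMILY OF RECORD IS A LOCAL STENCIL FAMILY** (coefficients `lamCoeffK (KInvStep Lc j) (E2 d Lc j) Lc`; lit-balaban's
`locStencil_SLam` fed `abs_lamCoeffK_le` at the common rate of `decays_KInvStep j` and `decays_E2 j`, and an1's `vertexFamily_symHessFFAt` — the letters of
an2 g28's `RecursiveStencilSlot.locStencil_SrecOf`, at the record). -/
theorem locStencil_SLam_lamCoeffK_an1TablesS2 (j : ℕ) :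
    ∃ C δ : ℝ, 0 ≤ C ∧ 0 < δ ∧
      LocStencil (SLam Lc (lamCoeffK (KInvStep (d := d) Lc j) (E2 d Lc j) Lc) (symHessFFAt (ctr (d + 1) Lc) Lc)) C δ := by
  obtain ⟨δA, CA, hδA, hCA, hA⟩ := decays_KInvStep (d := d) (Lc := Lc) j
  obtain ⟨δE, CE, hδE, hCE, hE⟩ := decays_E2 (d := d) (Lc := Lc) j
  have hLc : 1 ≤ Lc := Nat.one_le_iff_ne_zero.2 (NeZero.ne Lc)
  set n : ℝ := min δA δE with hn
  have hn0 : 0 < n := lt_min hδA hδE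
  have hA' : Decays (KInvStep (d := d) Lc j) CA n := decays_mono hA hCA le_rfl (min_le_left _ _)
  have hE' : Decays (E2 d Lc j) CE n := decays_mono hE hCE le_rfl (min_le_right _ _)
  have hc := abs_lamCoeffK_le hA' hE' hn0 Lc
  have hn2 : 0 < n / 2 := half_pos hn0
  have hQ := vertexFamily_symHessFFAt (d := d) hLc (ctrOff_mem_box hLc) hn2.le
  have h3 := locStencil_SLam (N := Lc) hc hQ hn2
    (mul_nonneg (mul_nonneg (Nat.cast_nonneg _) (mul_nonneg hCA hCE)) (ExpKernelCalculus.Zl_nonneg (by linarith)))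
  exact ⟨_, n / 2 / 2, (h3 0 0).nonneg (Sum.inl 0), half_pos hn2, h3⟩

omit [NeZero Lc] in
/-- [folklore] **(Λ-p)+(Λ-ff) ⟹ EACH MEMBER OF A Λ FAMILY ON THE RECORD TABLE IS FIBRE-TRANSPOSE-ODD AS A WHOLE KERNEL**, for ANY conversion coefficients `c`
(both levels' families are instances): `trF (SLam Lc c (symHessFFAt ρ_c Lc) κ u) = −SLam Lc c (symHessFFAt ρ_c Lc) κ u` (the family is field–field-supported, so
`sgnK` is the identity on it and (Λ-p) `trK V = −sgnK V` is plain oddness). -/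
theorem trF_SLam_an1TablesS2 (c : Fin (d + 1) → (Fin (d + 1) → ℤ) → Fin (d + 1) → (Fin (d + 1) → ℤ) → ℝ) (κ : Fin (d + 1)) (u : Site (d + 1)) :
    trF (SLam Lc c (symHessFFAt (ctr (d + 1) Lc) Lc) κ u) = -SLam Lc c (symHessFFAt (ctr (d + 1) Lc) Lc) κ u := by
  have h := trK_SLam_an1TablesS2 (Lc := Lc) c κ u
  funext x z a b
  have hx := congrFun (congrFun (congrFun (congrFun h x) z) a) b
  rw [trK_apply] at hx
  rw [show trF (SLam Lc c (symHessFFAt (ctr (d + 1) Lc) Lc) κ u) x z a b = SLam Lc c (symHessFFAt (ctr (d + 1) Lc) Lc) κ u z x b a from rfl, hx]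
  simp only [Pi.neg_apply, sgnK]
  rcases a with α | α <;> rcases b with β | β
  · rw [sgnF_inl, sgnF_inl, one_mul, one_mul]
  · rw [SLam_an1TablesS2_inl_inr, mul_zero, neg_zero]
  · rw [SLam_an1TablesS2_inr, mul_zero, neg_zero]
  · rw [SLam_an1TablesS2_inr, mul_zero, neg_zero]

variable {T M' : Fin (d + 1) → ℕ} [∀ μ, NeZero (T μ)]

omit [∀ μ, NeZero (T μ)] [NeZero Lc] in
/-- [folklore] **(Λ-per-p) EACH PERIODISED MEMBER OF A Λ FAMILY ON THE RECORD TABLE IS AN ANTISYMMETRIC MATRIX** (any coefficients `c`, any period box `T`). -/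
theorem perF_dper_SLam_an1TablesS2_transpose (c : Fin (d + 1) → (Fin (d + 1) → ℤ) → Fin (d + 1) → (Fin (d + 1) → ℤ) → ℝ)
    (κ : Fin (d + 1)) (u : Site (d + 1)) :
    (perF T (dper T (SLam Lc c (symHessFFAt (ctr (d + 1) Lc) Lc) κ u)))ᵀ = -perF T (dper T (SLam Lc c (symHessFFAt (ctr (d + 1) Lc) Lc) κ u)) :=
  perF_dper_transpose_of_trF (M := T) _ (trF_SLam_an1TablesS2 c κ u)

omit [∀ μ, NeZero (T μ)] [NeZero Lc] in
/-- [folklore] **`torus_Lam_family_transpose` — THE (β) DOOR's ROW `hΛt` FOR THE Λ FAMILIES OF RECORD, PER MEMBER, ANY COEFFICIENTS `c`, ANY WEIGHT `w`**,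
any period box `T`: `(Λ b)ᵀ = −Λ b` at `Λ b := w • (perF T (dper T (SLam Lc c (symHessFFAt ρ_c Lc) b.2 ↑b.1)))∘(fields, fields)` (level 0: `c = lamCoeffOf KInv Lc`;
level `j`: `c = lamCoeffK (KInvStep Lc j) (E2 d Lc j) Lc`). -/
theorem torus_Lam_family_transpose (c : Fin (d + 1) → (Fin (d + 1) → ℤ) → Fin (d + 1) → (Fin (d + 1) → ℤ) → ℝ) (w : ℝ)
    (b : ↥(pbox T) × Fin (d + 1)) :
    (w • (perF T (dper T (SLam Lc c (symHessFFAt (ctr (d + 1) Lc) Lc) b.2 (b.1 : Site (d + 1))))).submatrix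
        (fun b : ↥(pbox T) × Fin (d + 1) => ((b.1, Sum.inl b.2) : Idx T (Fib d)))
        (fun b : ↥(pbox T) × Fin (d + 1) => ((b.1, Sum.inl b.2) : Idx T (Fib d))))ᵀ
      = -(w • (perF T (dper T (SLam Lc c (symHessFFAt (ctr (d + 1) Lc) Lc) b.2 (b.1 : Site (d + 1))))).submatrix
        (fun b : ↥(pbox T) × Fin (d + 1) => ((b.1, Sum.inl b.2) : Idx T (Fib d)))
        (fun b : ↥(pbox T) × Fin (d + 1) => ((b.1, Sum.inl b.2) : Idx T (Fib d)))) := by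
  rw [Matrix.transpose_smul, Matrix.transpose_submatrix, perF_dper_SLam_an1TablesS2_transpose, ← smul_neg]
  rfl

/-- [folklore] **`torus_Lam_indexLaw` — THE (β) DOOR's ROW `hΛ` FOR THE Λ FAMILY OF RECORD, ANY WEIGHT** `w`, any period box `T` with `T = Lc·M′`
(block covariance (Λ-t), localisation (Λ-loc), gauge-nullity (Λ-g)₀ per fine site — `CombLamSectorLetters` + §1):
`Σ_b (Σ_s tgrad T (b.1, inl b.2) s · λ s) • Λ b = 0` for every torus gauge function `λ : ↥(pbox T) → ℝ`. -/
theorem torus_Lam_indexLaw (hT : ∀ i, T i = Lc * M' i) (w : ℝ) (lam : ↥(pbox T) → ℝ) :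
    ∑ b : ↥(pbox T) × Fin (d + 1), (∑ s : ↥(pbox T), tgrad T (b.1, Sum.inl b.2) s * lam s) •
        (w • (perF T (dper T (SLam Lc (lamCoeffOf (KInv (N := Lc) (d := d)) Lc) (symHessFFAt (ctr (d + 1) Lc) Lc) b.2 (b.1 : Site (d + 1))))).submatrix
          (fun b : ↥(pbox T) × Fin (d + 1) => ((b.1, Sum.inl b.2) : Idx T (Fib d)))
          (fun b : ↥(pbox T) × Fin (d + 1) => ((b.1, Sum.inl b.2) : Idx T (Fib d))))
      = 0 := by
  obtain ⟨C, δ, hC, hδ, hV⟩ := locStencil_SLam_an1TablesS2 (d := d) (Lc := Lc)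
  exact torus_indexLaw_ff_of_divV_eq_zero (M := T) _ hT (fun κ u t => (SLam_an1TablesS2_translate (d := d) (Lc := Lc) 0 κ u t).1) hV hC hδ
    (fun u => divV_SLam_lamCoeffOf_an1TablesS2_eq_zero (d := d) (Lc := Lc) 0 u) w lam

/-- [folklore] **`torus_Lam_indexLaw_lamCoeffK` — THE SAME ROW FOR THE LEVEL-`j` Λ FAMILY OF RECORD** (coefficients `lamCoeffK (KInvStep Lc j) (E2 d Lc j) Lc`;
(Λ-g)ⱼ `divV_SLam_lamCoeffK_an1TablesS2_eq_zero`, (Λ-t)ⱼ, (Λ-loc)ⱼ): any `T = Lc·M′`, any weight, any torus gauge function. -/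
theorem torus_Lam_indexLaw_lamCoeffK (hT : ∀ i, T i = Lc * M' i) (j : ℕ) (w : ℝ) (lam : ↥(pbox T) → ℝ) :
    ∑ b : ↥(pbox T) × Fin (d + 1), (∑ s : ↥(pbox T), tgrad T (b.1, Sum.inl b.2) s * lam s) •
        (w • (perF T (dper T (SLam Lc (lamCoeffK (KInvStep (d := d) Lc j) (E2 d Lc j) Lc) (symHessFFAt (ctr (d + 1) Lc) Lc)
            b.2 (b.1 : Site (d + 1))))).submatrix
          (fun b : ↥(pbox T) × Fin (d + 1) => ((b.1, Sum.inl b.2) : Idx T (Fib d)))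
          (fun b : ↥(pbox T) × Fin (d + 1) => ((b.1, Sum.inl b.2) : Idx T (Fib d))))
      = 0 := by
  obtain ⟨C, δ, hC, hδ, hV⟩ := locStencil_SLam_lamCoeffK_an1TablesS2 (d := d) (Lc := Lc) j
  exact torus_indexLaw_ff_of_divV_eq_zero (M := T) _ hT (fun κ u t => (SLam_an1TablesS2_translate (d := d) (Lc := Lc) j κ u t).2) hV hC hδ
    (fun u => divV_SLam_lamCoeffK_an1TablesS2_eq_zero (d := d) (Lc := Lc) 0 j u) w lam

/-! ### At the (III′) torus call's fine box `fine Lc M′` — leaf-02's binder types VERBATIM -/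

variable [∀ μ, NeZero (M' μ)]

omit [∀ μ, NeZero (M' μ)] [NeZero Lc] in
/-- [folklore] **`hΛt` AT THE CALL's TYPES** (`F = fine Lc M′`; any coefficients `c`, any weight `w`): `(Λ b)ᵀ = −Λ b`,
`Λ b := w • (perF (fine Lc M′) (dper (fine Lc M′) (SLam Lc c (symHessFFAt ρ_c Lc) b.2 ↑b.1)))∘(ff)`. -/
theorem torus_Lam_family_transpose_fine (c : Fin (d + 1) → (Fin (d + 1) → ℤ) → Fin (d + 1) → (Fin (d + 1) → ℤ) → ℝ) (w : ℝ)
    (b : ↥(pbox (fine Lc M')) × Fin (d + 1)) :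
    (w • (perF (fine Lc M') (dper (fine Lc M') (SLam Lc c (symHessFFAt (ctr (d + 1) Lc) Lc) b.2 (b.1 : Site (d + 1))))).submatrix
        (fun b : ↥(pbox (fine Lc M')) × Fin (d + 1) => ((b.1, Sum.inl b.2) : Idx (fine Lc M') (Fib d)))
        (fun b : ↥(pbox (fine Lc M')) × Fin (d + 1) => ((b.1, Sum.inl b.2) : Idx (fine Lc M') (Fib d))))ᵀ
      = -(w • (perF (fine Lc M') (dper (fine Lc M') (SLam Lc c (symHessFFAt (ctr (d + 1) Lc) Lc) b.2 (b.1 : Site (d + 1))))).submatrix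
        (fun b : ↥(pbox (fine Lc M')) × Fin (d + 1) => ((b.1, Sum.inl b.2) : Idx (fine Lc M') (Fib d)))
        (fun b : ↥(pbox (fine Lc M')) × Fin (d + 1) => ((b.1, Sum.inl b.2) : Idx (fine Lc M') (Fib d)))) :=
  torus_Lam_family_transpose (T := fine Lc M') c w b

/-- [folklore] **`hΛ` AT THE CALL's TYPES** (`F = fine Lc M′`, any weight `w`, any torus gauge function `λ`):
`Σ_b (Σ_s tgrad F (b.1, inl b.2) s · λ s) • Λ b = 0`. -/
theorem torus_Lam_indexLaw_fine (w : ℝ) (lam : ↥(pbox (fine Lc M')) → ℝ) :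
    ∑ b : ↥(pbox (fine Lc M')) × Fin (d + 1), (∑ s : ↥(pbox (fine Lc M')), tgrad (fine Lc M') (b.1, Sum.inl b.2) s * lam s) •
        (w • (perF (fine Lc M') (dper (fine Lc M')
            (SLam Lc (lamCoeffOf (KInv (N := Lc) (d := d)) Lc) (symHessFFAt (ctr (d + 1) Lc) Lc) b.2 (b.1 : Site (d + 1))))).submatrix
          (fun b : ↥(pbox (fine Lc M')) × Fin (d + 1) => ((b.1, Sum.inl b.2) : Idx (fine Lc M') (Fib d)))
          (fun b : ↥(pbox (fine Lc M')) × Fin (d + 1) => ((b.1, Sum.inl b.2) : Idx (fine Lc M') (Fib d))))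
      = 0 :=
  torus_Lam_indexLaw (T := fine Lc M') (M' := M') (fun _ => rfl) w lam

/-- [folklore] **`hΛ` AT THE CALL's TYPES, LEVEL `j`** (`F = fine Lc M′`; coefficients `lamCoeffK (KInvStep Lc j) (E2 d Lc j) Lc`). -/
theorem torus_Lam_indexLaw_lamCoeffK_fine (j : ℕ) (w : ℝ) (lam : ↥(pbox (fine Lc M')) → ℝ) :
    ∑ b : ↥(pbox (fine Lc M')) × Fin (d + 1), (∑ s : ↥(pbox (fine Lc M')), tgrad (fine Lc M') (b.1, Sum.inl b.2) s * lam s) •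
        (w • (perF (fine Lc M') (dper (fine Lc M')
            (SLam Lc (lamCoeffK (KInvStep (d := d) Lc j) (E2 d Lc j) Lc) (symHessFFAt (ctr (d + 1) Lc) Lc) b.2 (b.1 : Site (d + 1))))).submatrix
          (fun b : ↥(pbox (fine Lc M')) × Fin (d + 1) => ((b.1, Sum.inl b.2) : Idx (fine Lc M') (Fib d)))
          (fun b : ↥(pbox (fine Lc M')) × Fin (d + 1) => ((b.1, Sum.inl b.2) : Idx (fine Lc M') (Fib d))))
      = 0 :=
  torus_Lam_indexLaw_lamCoeffK (T := fine Lc M') (M' := M') (fun _ => rfl) j w lam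

end Record

end Summit.QuantumFields.BalabanUV.Beta.CombLamSectorPeriodised

end
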